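/-
Copyright (c) 2026 the pub-hodgecm-mathlib formalisation cell (harness21).  Prover seat hodgecm-mathlib-K2Liu-p05 (g3), 2026-09-04
(Track B «K2-LIT», crux hLiu418 = stmt-HodgeConjecture-24832, socket #42F′ `sig_K2LiuFirstTermIdentityOnGenerators`, ROAD I v3 («uniqueness road»,
RULING M-156b), organ U2a «no rank 2 on the line» — the HERM₂-CARRIER HEADS of LEAD F0P6-plan (g12) «= GO, 2 binder fixes» 06:13:10Z (F1)(F2)).
-/
import Summits.HodgeConjecture.HodgeConjecture.Theorems.K2LiuLineNoRankTwoCoinvariants   -- ★ p857826: §1 twisted partition trick, §2 moment map, §3 `M₂(R)` head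
import Mathlib.LinearAlgebra.Matrix.Hermitian
import HarnessLib

/-!
# U2a «NO RANK 2 ON THE LINE» — the Herm₂-carrier heads (F1)(F2)

Track B ∕ K2-LIT, hLiu418 = stmt-HodgeConjecture-24832, socket #42F′ `sig_K2LiuFirstTermIdentityOnGenerators` (U6 ED. 10 :767), ROAD I v3 organ U2a
(SIGS-RoadI-v3 §2 row U2a; RULING «M-156b»; DEAL «M-156c»).  Namespace
`Summit.HodgeConjecture.HodgeConjecture.Cruxes.HLiu418.K2LiuLineNoRankTwoCoinvariantsHerm`.  THEOREMS ONLY (no definition, no instance, no notation, no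
named fact, no `sorry`); kernel lane `--supports stmt-HodgeConjecture-24832 --as helper`; count-neutral.

WHY THIS FILE (LEAD F0P6-plan (g12), 2026-09-04T06:13:10Z, binder fixes (F1)(F2) to ★ p857826).  The landed head
`K2LiuLineNoRankTwoCoinvariants.lineNoRankTwoCoinvariants` reads the Siegel unipotent radical through a parametrisation `b : Z → M₂(R)` ONTO ALL of
`M₂(R)` and asks the pairing to detect every non-zero `H ∈ M₂(R)`.  At the dock this has NO instantiation: the unitary Siegel unipotent radical is
`N_{Δ,w} ≅ Herm₂(L_w)` (`L⁺_w`-dimension `4`, while `M₂(L_w)` has `8`), and the trace pairing `(b, H) ↦ Tr_{L_w∕L⁺_w} tr(b·H)` is non-degenerate on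
`Herm₂ × Herm₂` but kills every anti-hermitian `H` against all hermitian `b`.  The heads below are therefore typed RELATIVE TO THE HERMITIAN CARRIER:

* §1 (F2, submodule form) `exists_mem_addChar_pairing_ne_one`, `exists_mem_addChar_pairing_ne`, **`twistedCoinv_ker_eq_top_of_momentMap_ne_submodule`**,
  `eq_zero_of_twistedQuasiInvariant_of_momentMap_ne_submodule`: an `F`-submodule `S ⊆ B` (the hermitian parameters), `b : Z → B` onto `S`
  (`hbS`), a pairing `π` non-degenerate ON `S` (`hπ : ∀ H ∈ S, H ≠ 0 → ∃ s ∈ S, π s H ≠ 0`; the scaling step stays inside `S` because `S` is an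
  `F`-submodule and `ψ ≠ 1` on the scalar FIELD `F`, (F1)), a moment map `G` with `G x − β ∈ S`; if `G x ≠ β` for all `x` the `ψ_β`-coinvariants vanish.
* §2 (F2, hermitian Gram with ONE vector function) `isHermitian_smul_vecMulVec_star_self`, `isHermitian_algebraMap_smul_vecMulVec_star_self`,
  `det_algebraMap_smul_vecMulVec_star_self`, `algebraMap_smul_vecMulVec_star_self_ne_of_det_ne_zero`, **`lineNoRankTwoCoinvariants_herm`**,
  **`eq_zero_of_twistedQuasiInvariant_rankTwo`**, `subsingleton_lineCoinvariants_herm`: entries-ring `R` a commutative `F`-algebra with `star` (at the dock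
  `R = L_w = L ⊗ L⁺_v`, `star` = the conjugation of `L_w∕L⁺_w`, `F = L⁺_v` FIXED by `star`: hypothesis `hF : ∀ c, star (algebraMap F R c) = algebraMap F R c`),
  the Gram matrix of the pair `(v₀ e, v₁ e)` in the line `⟨e⟩` with `⟨e, e⟩ = a′ ∈ F` is `G x := algebraMap F R a′ • vecMulVec (star (v x)) (v x)` — HERMITIAN, of
  determinant `0` — so a hermitian `β` with `det β ≠ 0` is never a value of `G`; the unipotent radical is read through `b : Z → M₂(R)` onto the HERMITIAN
  matrices only (`hb : ∀ s, s.IsHermitian → ∃ z, b z = s`) and `π` detects non-zero HERMITIAN `H` by HERMITIAN `s` (`hπ`).  Conclusion: `TwistedCoinv.ker ρ ψ_β = ⊤`,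
  and (the sheet's «⊢» shape) every `ℓ` with `ℓ (ρ z φ) = ψ_β z • ℓ φ` is `0`.

(F3) of the ruling: `hπ` (non-degeneracy of the trace form on `Herm₂(L_w)`), `hψ`, `hρ` (the multiplier formula, LD2 (J1a) pattern) and `hχ` are left to the
instantiator; U2 consumes U2a at ONE finite place, which the assembler may pick non-split and odd.

HONEST LABEL: HC_CM is proved only modulo the 7 printed citations (2 remaining named inputs: hLiu418 = stmt-HodgeConjecture-24832, h413 =
stmt-HodgeConjecture-24833) until rung 0 closes; this file is one organ (U2a) of Road I for #42F′ and moves no counter.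

## References
* [Kudla1986] S. S. Kudla, *On the local theta-correspondence*, Invent. Math. 83 (1986) 229–255, proof of Thm. 2.8.
* [MoeglinVignerasWaldspurger1987] C. Mœglin, M.-F. Vignéras, J.-L. Waldspurger, LNM 1291 (1987), Chap. 2 II.1, Chap. 3 §IV.5.
* [Rallis1984] S. Rallis, *On the Howe duality conjecture*, Compositio Math. 51 (1984) 333–399, §4.
* [BernsteinZelevinsky1976] I. N. Bernstein, A. V. Zelevinsky, Russian Math. Surveys 31 (1976), §1.1, §2.30–2.33.
-/

set_option autoImplicit false
set_option linter.dupNamespace false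

noncomputable section

open Set
open Literature.NumberTheory.Automorphic Literature.RepresentationTheory
open Summit.HodgeConjecture.HodgeConjecture.Cruxes.HLiu418.K2LiuLineNoRankTwoCoinvariants

namespace Summit.HodgeConjecture.HodgeConjecture.Cruxes.HLiu418.K2LiuLineNoRankTwoCoinvariantsHerm

/-! ## §1 (F2, submodule form) The moment map misses `β` — relative to an `F`-submodule `S` of parameters -/

section Submodule

variable {F : Type*} [Field F] {B : Type*} [AddCommGroup B] [Module F B]
  (π : B →ₗ[F] B →ₗ[F] F) (S : Submodule F B) (hπ : ∀ H ∈ S, H ≠ 0 → ∃ s ∈ S, π s H ≠ 0)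
  (ψ : AddChar F Circle) (hψ : ∃ a : F, ((ψ a : Circle) : ℂ) ≠ 1)

include hπ hψ in
/-- **a non-zero `H ∈ S` is detected by the characters `s ↦ ψ(⟪s, H⟫)`, `s ∈ S`**: `ψ ≠ 1` on the scalar field `F` and `⟪·, H⟫|_S ≠ 0` is onto `F`
(the rescaled parameter `(a ∕ ⟪s₀, H⟫) • s₀` stays in the `F`-submodule `S`). [cite: MoeglinVignerasWaldspurger1987, Chap. 2 II.1] -/
theorem exists_mem_addChar_pairing_ne_one {H : B} (hHS : H ∈ S) (hH : H ≠ 0) : ∃ s ∈ S, ((ψ (π s H) : Circle) : ℂ) ≠ 1 := by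
  obtain ⟨s₀, hs₀S, hs₀⟩ := hπ H hHS hH
  obtain ⟨a, ha⟩ := hψ
  refine ⟨(a / π s₀ H) • s₀, S.smul_mem _ hs₀S, ?_⟩
  rwa [map_smul, LinearMap.smul_apply, smul_eq_mul, div_mul_cancel₀ a hs₀]

include hπ hψ in
/-- **if `G x ≠ β` with `G x − β ∈ S`, some multiplier `ψ(⟪s, G x⟫)`, `s ∈ S`, differs from the character value `ψ(⟪s, β⟫)`.**
[cite: MoeglinVignerasWaldspurger1987, Chap. 2 II.1] -/
theorem exists_mem_addChar_pairing_ne {Gx β : B} (hS : Gx - β ∈ S) (h : Gx ≠ β) :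
    ∃ s ∈ S, ((ψ (π s Gx) : Circle) : ℂ) ≠ ((ψ (π s β) : Circle) : ℂ) := by
  obtain ⟨s, hsS, hs⟩ := exists_mem_addChar_pairing_ne_one π S hπ ψ hψ hS (sub_ne_zero.2 h)
  refine ⟨s, hsS, fun heq => hs ?_⟩
  have hmul : ((ψ (π s Gx) : Circle) : ℂ) = ((ψ (π s (Gx - β)) : Circle) : ℂ) * ((ψ (π s β) : Circle) : ℂ) := by
    rw [← Circle.coe_mul, ← AddChar.map_add_eq_mul, map_sub, sub_add_cancel]
  rw [heq] at hmul
  exact (mul_eq_right₀ (Circle.coe_ne_zero _)).1 hmul.symm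

variable {X : Type*} [TopologicalSpace X] {Z : Type*} [Group Z]
  (ρ : Representation ℂ Z ↥(SchwartzBruhat X)) (b : Z → B) (hbS : ∀ s ∈ S, ∃ z, b z = s) (G : X → B) (β : B)
  (hu : ∀ z, IsLocallyConstant fun x => ((ψ (π (b z) (G x)) : Circle) : ℂ))
  (hρ : ∀ (z : Z) (φ : ↥(SchwartzBruhat X)),
    ((ρ z φ : ↥(SchwartzBruhat X)) : X → ℂ) = (fun x => ((ψ (π (b z) (G x)) : Circle) : ℂ)) * φ)
  (χ : Z →* ℂˣ) (hχ : ∀ z, ((χ z : ℂˣ) : ℂ) = ((ψ (π (b z) β) : Circle) : ℂ))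

include hπ hψ hbS hu hρ hχ in
/-- **THE MOMENT MAP MISSES `β` ⇒ NO `ψ_β`-COINVARIANTS — submodule form (F2).**  Let `Z` act on `𝒮(X)` by the second-degree multipliers
`x ↦ ψ(⟪b z, G x⟫)` of a moment map `G : X → B`, the parameters `b z` filling an `F`-submodule `S` (`hbS`) on which `π` is non-degenerate (`hπ`),
with `G x − β ∈ S` for all `x`; let `χ z = ψ(⟪b z, β⟫)`.  If `G x ≠ β` for every `x`, then `TwistedCoinv.ker ρ χ = ⊤` (`𝒮(X)_{Z,ψ_β} = 0`).
[cite: Kudla1986, proof of Thm. 2.8] [cite: Rallis1984, §4] [cite: MoeglinVignerasWaldspurger1987, Chap. 3 §IV.5] -/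
theorem twistedCoinv_ker_eq_top_of_momentMap_ne_submodule :
    (∀ x, G x - β ∈ S) → (∀ x, G x ≠ β) → TwistedCoinv.ker ρ χ = ⊤ := by
  intro hGβ hβ
  refine twistedCoinv_ker_eq_top_of_forall_exists_ne ρ (fun z x => ((ψ (π (b z) (G x)) : Circle) : ℂ)) hu hρ χ fun x => ?_
  obtain ⟨s, hsS, hs⟩ := exists_mem_addChar_pairing_ne π S hπ ψ hψ (hGβ x) (hβ x)
  obtain ⟨z, rfl⟩ := hbS s hsS
  exact ⟨z, by rw [hχ]; exact hs⟩

include hπ hψ hbS hu hρ hχ in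
/-- **… hence every `(Z, ψ_β)`-QUASI-INVARIANT FUNCTIONAL VANISHES** (the sheet's «⊢» shape: `∀ ℓ, (∀ z φ, ℓ (ρ z φ) = ψ_β z • ℓ φ) → ℓ = 0`).
[cite: MoeglinVignerasWaldspurger1987, Chap. 3 §IV.5] [cite: BernsteinZelevinsky1976, §2.30–2.33] -/
theorem eq_zero_of_twistedQuasiInvariant_of_momentMap_ne_submodule {M : Type*} [AddCommGroup M] [Module ℂ M] :
    (∀ x, G x - β ∈ S) → (∀ x, G x ≠ β) →
      ∀ ℓ : ↥(SchwartzBruhat X) →ₗ[ℂ] M, (∀ (z : Z) (φ : ↥(SchwartzBruhat X)), ℓ (ρ z φ) = ((χ z : ℂˣ) : ℂ) • ℓ φ) → ℓ = 0 := by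
  intro hGβ hβ ℓ hℓ
  refine LinearMap.ext fun φ => ?_
  rw [LinearMap.zero_apply]
  refine TwistedCoinv.ker_le_ker ρ χ ℓ hℓ ?_
  rw [twistedCoinv_ker_eq_top_of_momentMap_ne_submodule π S hπ ψ hψ ρ b hbS G β hu hρ χ hχ hGβ hβ]
  exact Submodule.mem_top

end Submodule

/-! ## §2 (F2, hermitian Gram) The head on the Herm₂ carrier: the Gram matrix of a pair in a hermitian LINE is hermitian of rank `≤ 1` -/

section HermGram

variable {R : Type*} [CommRing R] [StarRing R]

/-- **the Gram matrix `a · (v̄ᵢ vⱼ)` of a pair of vectors `v₀ e, v₁ e` in a hermitian line `⟨e⟩` (`⟨e, e⟩ = a = ā`) is HERMITIAN.** [cite: Rallis1984, §4] -/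
theorem isHermitian_smul_vecMulVec_star_self {a : R} (ha : star a = a) {ι : Type*} (v : ι → R) :
    (a • Matrix.vecMulVec (star v) v).IsHermitian := by
  refine Matrix.IsHermitian.ext fun i j => ?_
  simp only [Matrix.smul_apply, Matrix.vecMulVec_apply, smul_eq_mul, Pi.star_apply, star_mul', star_star, ha]
  ring

variable {F : Type*} [Field F] [Algebra F R] (hF : ∀ c : F, star (algebraMap F R c) = algebraMap F R c)

include hF in
/-- **… in particular for `a = a′ ∈ F ⊆ R^{star}`** (the scalar field is fixed by the involution: `hF`). [cite: Rallis1984, §4] -/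
theorem isHermitian_algebraMap_smul_vecMulVec_star_self (a' : F) {ι : Type*} (v : ι → R) :
    (algebraMap F R a' • Matrix.vecMulVec (star v) v).IsHermitian :=
  isHermitian_smul_vecMulVec_star_self (hF a') v

/-- **`det (a′ · v̄ ⊗ v) = 0`**: the Gram matrix of a PAIR of vectors in a LINE has rank `≤ 1`. [cite: Rallis1984, §4] -/
theorem det_algebraMap_smul_vecMulVec_star_self (a' : F) (v : Fin 2 → R) :
    (algebraMap F R a' • Matrix.vecMulVec (star v) v).det = 0 :=
  det_smul_vecMulVec_fin_two (algebraMap F R a') (star v) v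

/-- **… so a non-degenerate `β` (`det β ≠ 0`) is never such a Gram matrix.** [cite: Rallis1984, §4] -/
theorem algebraMap_smul_vecMulVec_star_self_ne_of_det_ne_zero (a' : F) (v : Fin 2 → R) {β : Matrix (Fin 2) (Fin 2) R}
    (hβ : β.det ≠ 0) : algebraMap F R a' • Matrix.vecMulVec (star v) v ≠ β :=
  smul_vecMulVec_ne_of_det_ne_zero (algebraMap F R a') (star v) v hβ

variable (π : Matrix (Fin 2) (Fin 2) R →ₗ[F] Matrix (Fin 2) (Fin 2) R →ₗ[F] F)
  (hπ : ∀ H : Matrix (Fin 2) (Fin 2) R, H.IsHermitian → H ≠ 0 → ∃ s : Matrix (Fin 2) (Fin 2) R, s.IsHermitian ∧ π s H ≠ 0)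
  (ψ : AddChar F Circle) (hψ : ∃ a : F, ((ψ a : Circle) : ℂ) ≠ 1)
  {X : Type*} [TopologicalSpace X] {Z : Type*} [Group Z] (ρ : Representation ℂ Z ↥(SchwartzBruhat X))
  (b : Z → Matrix (Fin 2) (Fin 2) R) (hb : ∀ s : Matrix (Fin 2) (Fin 2) R, s.IsHermitian → ∃ z, b z = s)
  (a' : F) (v : X → Fin 2 → R) (β : Matrix (Fin 2) (Fin 2) R)
  (hu : ∀ z, IsLocallyConstant fun x => ((ψ (π (b z) (algebraMap F R a' • Matrix.vecMulVec (star (v x)) (v x))) : Circle) : ℂ))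
  (hρ : ∀ (z : Z) (φ : ↥(SchwartzBruhat X)),
    ((ρ z φ : ↥(SchwartzBruhat X)) : X → ℂ) =
      (fun x => ((ψ (π (b z) (algebraMap F R a' • Matrix.vecMulVec (star (v x)) (v x))) : Circle) : ℂ)) * φ)
  (χ : Z →* ℂˣ) (hχ : ∀ z, ((χ z : ℂˣ) : ℂ) = ((ψ (π (b z) β) : Circle) : ℂ))

include hF hπ hψ hb hu hρ hχ in
/-- **U2a «NO RANK 2 ON THE LINE» — Herm₂ carrier (F1)(F2).**  Entries-ring `R` a commutative `F`-algebra with involution `star` fixing the scalar FIELD `F`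
(`hF`; at the dock `R = L_w`, `F = L⁺_v`), additive character `ψ ≠ 1` of `F`.  In any Schrödinger-type model `𝒮(X)` in which the Siegel unipotent radical
— read through `b : Z → M₂(R)` onto the HERMITIAN matrices (`hb`) — acts by the second-degree multipliers `x ↦ ψ(⟪b z, a′ · v̄(x) ⊗ v(x)⟫)` of the
HERMITIAN GRAM MATRIX of the pair `(v₀(x) e, v₁(x) e)` of vectors of the line `⟨e⟩`, `⟨e, e⟩ = a′ ∈ F`, with `π` detecting non-zero hermitian `H` by
hermitian parameters (`hπ`), the `ψ_β`-twisted coinvariants (`ψ_β z = ψ(⟪b z, β⟫)`, `β` HERMITIAN) VANISH as soon as `det β ≠ 0`: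
**`TwistedCoinv.ker ρ ψ_β = ⊤`**, i.e. `𝒮(a′²_w)_{N_w, ψ_β} = 0`. [cite: Kudla1986, proof of Thm. 2.8] [cite: Rallis1984, §4]
[cite: MoeglinVignerasWaldspurger1987, Chap. 3 §IV.5] -/
theorem lineNoRankTwoCoinvariants_herm : β.IsHermitian → β.det ≠ 0 → TwistedCoinv.ker ρ χ = ⊤ := by
  intro hβh hβ
  -- `Herm₂(R)` as an `F`-submodule of `M₂(R)` (closed under `F`-scaling because `F` is fixed by `star`)
  let S : Submodule F (Matrix (Fin 2) (Fin 2) R) :=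
    { carrier := {H | H.IsHermitian}
      add_mem' := fun hA hB => hA.add hB
      zero_mem' := Matrix.isHermitian_zero
      smul_mem' := fun c H hH => by
        show (c • H).IsHermitian
        rw [← algebraMap_smul R c H]
        exact hH.smul (hF c) }
  have hmem : ∀ {H : Matrix (Fin 2) (Fin 2) R}, H ∈ S ↔ H.IsHermitian := fun {H} => Iff.rfl
  refine twistedCoinv_ker_eq_top_of_momentMap_ne_submodule π S (fun H hH hH0 => ?_) ψ hψ ρ b (fun s hs => hb s (hmem.1 hs))
    (fun x => algebraMap F R a' • Matrix.vecMulVec (star (v x)) (v x)) β hu hρ χ hχ (fun x => ?_)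
    (fun x => algebraMap_smul_vecMulVec_star_self_ne_of_det_ne_zero a' (v x) hβ)
  · obtain ⟨s, hs, hsH⟩ := hπ H (hmem.1 hH) hH0
    exact ⟨s, hmem.2 hs, hsH⟩
  · exact hmem.2 ((isHermitian_algebraMap_smul_vecMulVec_star_self hF a' (v x)).sub hβh)

include hF hπ hψ hb hu hρ hχ in
/-- **… hence the `(N_w, ψ_β)`-twisted «Siegel–Whittaker» functional of the line VANISHES for hermitian `β` with `det β ≠ 0`** — the sheet's «⊢» shape:
every `ℓ` on `𝒮(X)` with `ℓ (ρ z φ) = ψ_β z • ℓ φ` is `0`. [cite: Rallis1984, §4] [cite: MoeglinVignerasWaldspurger1987, Chap. 3 §IV.5] -/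
theorem eq_zero_of_twistedQuasiInvariant_rankTwo {M : Type*} [AddCommGroup M] [Module ℂ M] :
    β.IsHermitian → β.det ≠ 0 →
      ∀ ℓ : ↥(SchwartzBruhat X) →ₗ[ℂ] M, (∀ (z : Z) (φ : ↥(SchwartzBruhat X)), ℓ (ρ z φ) = ((χ z : ℂˣ) : ℂ) • ℓ φ) → ℓ = 0 := by
  intro hβh hβ ℓ hℓ
  refine LinearMap.ext fun φ => ?_
  rw [LinearMap.zero_apply]
  refine TwistedCoinv.ker_le_ker ρ χ ℓ hℓ ?_
  rw [lineNoRankTwoCoinvariants_herm hF π hπ ψ hψ ρ b hb a' v β hu hρ χ hχ hβh hβ]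
  exact Submodule.mem_top

include hF hπ hψ hb hu hρ hχ in
/-- **… and the `ψ_β`-coinvariant module is `0`.** [cite: Kudla1986, proof of Thm. 2.8] [cite: Rallis1984, §4] -/
theorem subsingleton_lineCoinvariants_herm : β.IsHermitian → β.det ≠ 0 → Subsingleton (TwistedCoinv.Coinv ρ χ) := by
  intro hβh hβ
  refine ⟨fun p q => ?_⟩
  obtain ⟨φ, rfl⟩ := TwistedCoinv.mk_surjective ρ χ p
  obtain ⟨φ', rfl⟩ := TwistedCoinv.mk_surjective ρ χ q
  have h0 : ∀ θ : ↥(SchwartzBruhat X), TwistedCoinv.mk ρ χ θ = 0 := fun θ => by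
    rw [TwistedCoinv.mk_apply, Submodule.Quotient.mk_eq_zero,
      lineNoRankTwoCoinvariants_herm hF π hπ ψ hψ ρ b hb a' v β hu hρ χ hχ hβh hβ]
    exact Submodule.mem_top
  rw [h0, h0]

end HermGram

end Summit.HodgeConjecture.HodgeConjecture.Cruxes.HLiu418.K2LiuLineNoRankTwoCoinvariantsHerm

end
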